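import Summits.QuantumFields.BalabanUV.T4Continuum.Support.B13AvgCorrStokes

/-!
# B13AvgCorrStokesVariation — row NE5, J-avg-reg SECOND ORDER (owner R60 l.24769, INTENT g39-d l.24783, dagwriter Q52 (2) l.24813;
# memo `t4/T4-EST-NE5-JAVG-SECOND.md` §4 row P1-b), leaf σ-L1 «STOKES FOR DIFFERENCES», file 1∕2: THE TWO-FIELD SWAP ∕ CANCELLATION
# CALCULUS — ONE ADJACENT SWAP CHANGES THE TWO-FIELD DEFECT OF A WORD BY AT MOST `s₁ + 2·s·t·(n + 2)`

Cell `pub-balaban`, unit `b2b-balaban-t4-ne5-formalise-leaf-10` (NE5 formalisation swarm LEAF PROVER 10, gen 16; CLAIM σ-L1 journal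
l.24964).  Summits-side NEW WORK under the LEAN PLACEMENT RULE: a [folklore] group-valued lattice calculus on OUR torus walk objects
(`T4Continuum.walk` ∕ `holAt`, file 1∕2 `B13AvgCorrStokes` of leaf κ-L1); 0 `def`, no `Prop`-valued fact minted, nothing printed
asserted, no citation tag.  HONEST FRAMING: rung (B)+1 of the FINITE-VOLUME T⁴ programme — NOT infinite volume, NOT a mass gap, NOT the
Clay problem, NOT a proof of NE5 (NOT PRINTED; GAPS G-t4-U3-1); nothing of [Balaban1985Averaging] ∕ [Balaban1985BackgroundPropagators] ∕
[Balaban1987RG1] is instantiated or discharged here.  HONEST DEPENDENCY (cell, verbatim): continuum YM on T⁴ ⇐ BetaPertH ∧ nine spine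
estimates (0/9 proved); BetaPertH ⇐ (D1) ∧ (D4) ∧ CAP+tail; G-an2-4 gates asym, D1 and NE2/3/4.

WHY.  The (ℓ2)(ℓ4) letters of the W1 chain need, besides the second-order window letter β″, a FIRST-DIFFERENCE letter for the (0.4)
correction factors, `‖C(τ_ν i) − C(i)‖ ≤ ρ₁∕ℓ³` (owner g39-d §2; memo (C1)).  Its instance is the variation of a (0.4) loop holonomy under a
coarse translation, i.e. the comparison of the holonomies of the SAME word read in TWO fields `U` and `U′ = U ∘ τ_v`.  The first-order
telescoping gives only `|w|·t = O(1∕ℓ²)` (R60 (3): «one order SHORT»); the swap road of κ-L1, run for the two fields in parallel,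
trades `|w|·t` for `area(w)·(s₁ + 2·s·t·(n+2))` — second-order letters (file 2∕2 `B13AvgCorrStokesVariationLoop`).  The lemma is
FIELD-PAIR GENERIC: nothing here knows that `U′` is a translate.
LETTERS (all displayed, all `≥ 0`): `s` = κ-L1's ordered-pair plaquette smallness of `U` (verbatim binder `hs`); `s₁` = the plaquette
VARIATION `dist1 (P′·P⁻¹) ≤ s₁` (`P` = `U`'s ordered-pair plaquette variable, `P′` = `U′`'s); `t` = the bond variation
`dist1 (U′ b·(U b)⁻¹) ≤ t`; and ONE displayed group hypothesis `hcomm : dist1 (a·b·a⁻¹·b⁻¹) ≤ 2·dist1 a·dist1 b` (true in every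
unitary matrix model — κ-L2 `B13AvgCorrPlaquette.norm_commutator_le` with `‖ι g − 1‖ = dist1 g` — kept as a binder so that this file
stays at the `GaugeGroup` interface like κ-L1; discharged at the instance).
The TWO-FIELD DEFECT of a word `w` from `x` is `dist1 (holAt U′ (walk x w) · (holAt U (walk x w))⁻¹)` (written out; no `def`).
* §0 quotient calculus: `dist1_quot_mul_le`, `dist1_quot_inv`, `dist1_conj_quot_le` (a conjugated plaquette read in two fields:
  `dist1 (k′P′k′⁻¹·(kPk⁻¹)⁻¹) ≤ dist1 (P′P⁻¹) + 2·dist1 P·dist1 (k′k⁻¹)`), `dist1_frame_change` (the swap's frame change),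
  `dist1_holAt_two_le` (`≤ |γ|·t`), `length_walk`.
* §1 `dist1_pair_swap_quot`: κ-L1's swap quotients `Q = hol_y[l₁,l₂]·hol_y[l₂,l₁]⁻¹` of the two fields satisfy
  `dist1 (Q′·Q⁻¹) ≤ s₁ + 4·s·t` (the four cases of `B13AvgCorrStokes.dist1_holAt_pair_swap`, each quotient an explicit conjugated plaquette).
* §2 words in context, length budget `n`: `dist1_two_swap` (`+ (s₁ + 2·s·t·(n+2))`), `dist1_two_cancel` (`=`), `dist1_two_letter_past`
  (`+ |B|·C`), `dist1_two_block_past` (`+ |A|·|B|·C`), `dist1_two_cancel_runs` (`=`).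
* §3 `plaq_pair_diff_bound_of_plaqHol`: the `plaqHol` form of `hs₁`.
0 sorry; axioms ⊆ {propext, Classical.choice, Quot.sound}.
-/

noncomputable section

namespace Summit.QuantumFields.BalabanUV.T4Continuum.B13AvgCorrStokesVariation

open Literature.MathematicalPhysics.QuantumFieldTheory.Balaban1983to89
open Literature.MathematicalPhysics.QuantumFieldTheory.Balaban1983to89.T4Continuum
open Literature.MathematicalPhysics.QuantumFieldTheory.Balaban1983to89.B15.PrelimIntegrations (dist1_fluct_le)
open Summit.QuantumFields.BalabanUV.T4Continuum.B13AvgCorrStokes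

variable {P : Params} {j : ℕ} {G : Type*} [GaugeGroup G]

/-! ## §0 Quotient calculus for two fields -/

/-- [folklore] the two-field defect of a product: `dist1 (a′b′(ab)⁻¹) ≤ dist1 (a′a⁻¹) + dist1 (b′b⁻¹)`. -/
theorem dist1_quot_mul_le (a a' b b' : G) : dist1 (a' * b' * (a * b)⁻¹) ≤ dist1 (a' * a⁻¹) + dist1 (b' * b⁻¹) := by
  have e : a' * b' * (a * b)⁻¹ = a' * (b' * b⁻¹) * a'⁻¹ * (a' * a⁻¹) := by group
  rw [e]
  refine (GaugeGroup.dist1_mul_le _ _).trans ?_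
  rw [GaugeGroup.dist1_conj, add_comm]

/-- [folklore] the two-field defect of an inverse: `dist1 (a′⁻¹(a⁻¹)⁻¹) = dist1 (a′a⁻¹)`. -/
theorem dist1_quot_inv (a a' : G) : dist1 (a'⁻¹ * (a⁻¹)⁻¹) = dist1 (a' * a⁻¹) := by
  have e : a'⁻¹ * (a⁻¹)⁻¹ = a'⁻¹ * (a' * a⁻¹)⁻¹ * a'⁻¹⁻¹ := by group
  rw [e, GaugeGroup.dist1_conj, GaugeGroup.dist1_inv]

/-- [folklore] `dist1 (k′⁻¹k) = dist1 (k′k⁻¹)`. -/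
theorem dist1_inv_mul_eq (k k' : G) : dist1 (k'⁻¹ * k) = dist1 (k' * k⁻¹) := by
  have e : k'⁻¹ * k = k'⁻¹ * (k' * k⁻¹)⁻¹ * k'⁻¹⁻¹ := by group
  rw [e, GaugeGroup.dist1_conj, GaugeGroup.dist1_inv]

/-- [folklore] **A CONJUGATED ELEMENT READ IN TWO FIELDS.**  Under the commutator hypothesis,
`dist1 (k′P′k′⁻¹ · (kPk⁻¹)⁻¹) ≤ dist1 (P′P⁻¹) + 2·dist1 P·dist1 (k′k⁻¹)`: conjugating by `k′⁻¹` the quotient reads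
`(P′P⁻¹)·(P h P⁻¹ h⁻¹)` with `h = k′⁻¹k`. -/
theorem dist1_conj_quot_le (hcomm : ∀ a b : G, dist1 (a * b * a⁻¹ * b⁻¹) ≤ 2 * dist1 a * dist1 b) (P P' k k' : G) :
    dist1 (k' * P' * k'⁻¹ * (k * P * k⁻¹)⁻¹) ≤ dist1 (P' * P⁻¹) + 2 * dist1 P * dist1 (k' * k⁻¹) := by
  have e : k' * P' * k'⁻¹ * (k * P * k⁻¹)⁻¹ = k' * (P' * P⁻¹ * (P * (k'⁻¹ * k) * P⁻¹ * (k'⁻¹ * k)⁻¹)) * k'⁻¹ := by group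
  rw [e, GaugeGroup.dist1_conj]
  refine (GaugeGroup.dist1_mul_le _ _).trans ?_
  rw [← dist1_inv_mul_eq k k']
  linarith [hcomm P (k'⁻¹ * k)]

/-- [folklore] **THE FRAME CHANGE OF A SWAP, TWO FIELDS.**  For `M = Q·M̃` read in two fields (`Q := M·M̃⁻¹`, `Q′ := M′·M̃′⁻¹`):
`dist1 (A′M′C′(AMC)⁻¹) ≤ dist1 (A′M̃′C′(AM̃C)⁻¹) + dist1 (Q′Q⁻¹) + 2·dist1 Q·dist1 (A′A⁻¹)` — the quotient of the swapped words is
conjugated by `R′ = A′Q′A′⁻¹` on the left and `R = AQA⁻¹` on the right, and `dist1 (R′R⁻¹) = dist1 (Q′gQ⁻¹g⁻¹)`, `g = A′⁻¹A`. -/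
theorem dist1_frame_change (hcomm : ∀ a b : G, dist1 (a * b * a⁻¹ * b⁻¹) ≤ 2 * dist1 a * dist1 b)
    (A A' M M' Mt Mt' C C' : G) :
    dist1 (A' * (M' * C') * (A * (M * C))⁻¹) ≤
      dist1 (A' * (Mt' * C') * (A * (Mt * C))⁻¹) + dist1 (M' * Mt'⁻¹ * (M * Mt⁻¹)⁻¹) +
        2 * dist1 (M * Mt⁻¹) * dist1 (A' * A⁻¹) := by
  set Q := M * Mt⁻¹ with hQ
  set Q' := M' * Mt'⁻¹ with hQ'
  set X := A' * (Mt' * C') * (A * (Mt * C))⁻¹ with hX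
  -- `A′M′C′(AMC)⁻¹ = (A′Q′A′⁻¹)·X·(A′Q′A′⁻¹)⁻¹ · ((A′Q′A′⁻¹)·(AQA⁻¹)⁻¹)`
  have e : A' * (M' * C') * (A * (M * C))⁻¹ =
      (A' * Q' * A'⁻¹) * X * (A' * Q' * A'⁻¹)⁻¹ * ((A' * Q' * A'⁻¹) * (A * Q * A⁻¹)⁻¹) := by
    rw [hX, hQ, hQ']; group
  have e2 : (A' * Q' * A'⁻¹) * (A * Q * A⁻¹)⁻¹ = A' * (Q' * Q⁻¹ * (Q * (A'⁻¹ * A) * Q⁻¹ * (A'⁻¹ * A)⁻¹)) * A'⁻¹ := by group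
  rw [e]
  have h1 : dist1 ((A' * Q' * A'⁻¹) * X * (A' * Q' * A'⁻¹)⁻¹ * ((A' * Q' * A'⁻¹) * (A * Q * A⁻¹)⁻¹)) ≤
      dist1 X + dist1 ((A' * Q' * A'⁻¹) * (A * Q * A⁻¹)⁻¹) := by
    refine (GaugeGroup.dist1_mul_le _ _).trans ?_
    rw [GaugeGroup.dist1_conj]
  have h2 : dist1 ((A' * Q' * A'⁻¹) * (A * Q * A⁻¹)⁻¹) ≤ dist1 (Q' * Q⁻¹) + 2 * dist1 Q * dist1 (A' * A⁻¹) := by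
    rw [e2, GaugeGroup.dist1_conj]
    refine (GaugeGroup.dist1_mul_le _ _).trans ?_
    rw [← dist1_inv_mul_eq A A']
    linarith [hcomm Q (A'⁻¹ * A)]
  linarith

/-- [folklore] the walk of a word has as many steps as the word has letters. -/
theorem length_walk : ∀ (x : Site P j) (w : List (Letter P.d)), (walk x w).length = w.length
  | _, [] => rfl
  | x, (μ, true) :: w => by simp only [walk, List.length_cons, length_walk (x.shift μ) w]
  | x, (μ, false) :: w => by simp only [walk, List.length_cons, length_walk (x.unshift μ) w]

/-- [folklore] **FIRST-ORDER TELESCOPING**: along any step sequence the holonomies of two fields differ by at most `|γ|·t`. -/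
theorem dist1_holAt_two_le (U U' : GaugeField P j G) {t : ℝ} (ht : ∀ b, dist1 (U' b * (U b)⁻¹) ≤ t) :
    ∀ γ : List (LStep P j), dist1 (holAt U' γ * (holAt U γ)⁻¹) ≤ γ.length * t
  | [] => by simp [holAt_nil, GaugeGroup.dist1_one]
  | st :: γ => by
    rw [holAt_cons, holAt_cons, List.length_cons, Nat.cast_succ, add_mul, one_mul, add_comm]
    refine (dist1_quot_mul_le _ _ _ _).trans (add_le_add ?_ (dist1_holAt_two_le U U' ht γ))
    cases st.fwd
    · simp only [Bool.false_eq_true, ↓reduceIte, dist1_quot_inv]; exact ht _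
    · simp only [↓reduceIte]; exact ht _

/-- [folklore] the same for the walk of a word: `≤ |w|·t`. -/
theorem dist1_holAt_walk_two_le (U U' : GaugeField P j G) {t : ℝ} (ht : ∀ b, dist1 (U' b * (U b)⁻¹) ≤ t)
    (x : Site P j) (w : List (Letter P.d)) :
    dist1 (holAt U' (walk x w) * (holAt U (walk x w))⁻¹) ≤ w.length * t := by
  rw [← length_walk x w]; exact dist1_holAt_two_le U U' ht _

/-! ## §1 Two letters: the swap quotients of two fields -/

section Pair

variable (U U' : GaugeField P j G) {s s₁ t : ℝ} (hs0 : 0 ≤ s) (hs₁0 : 0 ≤ s₁) (ht0 : 0 ≤ t)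
  (hcomm : ∀ a b : G, dist1 (a * b * a⁻¹ * b⁻¹) ≤ 2 * dist1 a * dist1 b)
  (hs : ∀ (y : Site P j) (μ ν : Fin P.d), μ ≠ ν →
    dist1 (U ⟨y, μ⟩ * U ⟨y.shift μ, ν⟩ * (U ⟨y.shift ν, μ⟩)⁻¹ * (U ⟨y, ν⟩)⁻¹) ≤ s)
  (hs₁ : ∀ (y : Site P j) (μ ν : Fin P.d), μ ≠ ν →
    dist1 (U' ⟨y, μ⟩ * U' ⟨y.shift μ, ν⟩ * (U' ⟨y.shift ν, μ⟩)⁻¹ * (U' ⟨y, ν⟩)⁻¹ *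
      (U ⟨y, μ⟩ * U ⟨y.shift μ, ν⟩ * (U ⟨y.shift ν, μ⟩)⁻¹ * (U ⟨y, ν⟩)⁻¹)⁻¹) ≤ s₁)
  (ht : ∀ b, dist1 (U' b * (U b)⁻¹) ≤ t)

include hs0 hs₁0 ht0 hcomm hs hs₁ ht in
/-- [folklore] **THE TWO-FIELD SWAP QUOTIENT.**  With `Q := hol_U(y,[l₁,l₂])·hol_U(y,[l₂,l₁])⁻¹` (κ-L1's swap quotient,
`dist1 Q ≤ s`) and `Q′` the same for `U′`: `dist1 (Q′·Q⁻¹) ≤ s₁ + 4·s·t` — both quotients are `1` when the letters share an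
axis, and the SAME conjugate `k·P^{±1}·k⁻¹` of one ordered-pair plaquette variable otherwise (`k` a product of at most two bond
variables), read in the two fields. -/
theorem dist1_pair_swap_quot (y : Site P j) (l₁ l₂ : Letter P.d) :
    dist1 (holAt U' (walk y [l₁, l₂]) * (holAt U' (walk y [l₂, l₁]))⁻¹ *
        (holAt U (walk y [l₁, l₂]) * (holAt U (walk y [l₂, l₁]))⁻¹)⁻¹) ≤ s₁ + 4 * s * t := by
  have hst : 0 ≤ s * t := mul_nonneg hs0 ht0
  -- the two-bond and one-bond conjugators
  have hk2 : ∀ b₁ b₂ : PBond P j, dist1 ((U' b₁ * U' b₂)⁻¹ * ((U b₁ * U b₂)⁻¹)⁻¹) ≤ 2 * t := fun b₁ b₂ => by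
    rw [dist1_quot_inv]
    exact (dist1_quot_mul_le _ _ _ _).trans (by linarith [ht b₁, ht b₂])
  have hk1 : ∀ b : PBond P j, dist1 ((U' b)⁻¹ * ((U b)⁻¹)⁻¹) ≤ t := fun b => by rw [dist1_quot_inv]; exact ht b
  -- the generic step: a conjugated plaquette (or its inverse) read in the two fields
  have key : ∀ (Pl Pl' k k' : G), dist1 Pl ≤ s → dist1 (Pl' * Pl⁻¹) ≤ s₁ → dist1 (k' * k⁻¹) ≤ 2 * t →
      dist1 (k' * Pl' * k'⁻¹ * (k * Pl * k⁻¹)⁻¹) ≤ s₁ + 4 * s * t ∧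
        dist1 (k' * Pl'⁻¹ * k'⁻¹ * (k * Pl⁻¹ * k⁻¹)⁻¹) ≤ s₁ + 4 * s * t := by
    intro Pl Pl' k k' hP hP' hk
    have hPn : 0 ≤ dist1 Pl := GaugeGroup.dist1_nonneg _
    constructor
    · refine (dist1_conj_quot_le hcomm Pl Pl' k k').trans ?_
      nlinarith [GaugeGroup.dist1_nonneg (k' * k⁻¹)]
    · refine (dist1_conj_quot_le hcomm Pl⁻¹ Pl'⁻¹ k k').trans ?_
      rw [dist1_quot_inv, GaugeGroup.dist1_inv]
      nlinarith [GaugeGroup.dist1_nonneg (k' * k⁻¹)]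
  obtain ⟨μ, b₁⟩ := l₁
  obtain ⟨ν, b₂⟩ := l₂
  by_cases hμν : μ = ν
  · subst hμν
    have h0 : (0 : ℝ) ≤ s₁ + 4 * s * t := by positivity
    cases b₁ <;> cases b₂ <;>
      simpa [walk, holAt_cons, holAt_nil, Site.unshift_shift, GaugeGroup.dist1_one] using h0
  · cases b₁ <;> cases b₂
    · -- `(μ,−), (ν,−)`: plaquette at `z = y − e_μ − e_ν`, conjugator `(U⟨z,μ⟩U⟨z+e_μ,ν⟩)⁻¹`
      obtain ⟨z, rfl⟩ : ∃ z, y = (z.shift μ).shift ν := ⟨(y.unshift ν).unshift μ, by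
        rw [Site.shift_unshift, Site.shift_unshift]⟩
      have h := (key _ _ ((U ⟨z, μ⟩ * U ⟨z.shift μ, ν⟩)⁻¹) ((U' ⟨z, μ⟩ * U' ⟨z.shift μ, ν⟩)⁻¹)
        (hs z μ ν hμν) (hs₁ z μ ν hμν) (hk2 _ _)).1
      simp only [walk, holAt_cons, holAt_nil, mul_one, Bool.false_eq_true, if_false,
        T4ReflectionCone.shift_shift_unshift, Site.unshift_shift]
      convert h using 2
      group
    · -- `(μ,−), (ν,+)`: plaquette `(ν, μ)` at `z = y − e_μ`, conjugator `U⟨z,μ⟩⁻¹`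
      obtain ⟨z, rfl⟩ : ∃ z, y = z.shift μ := ⟨y.unshift μ, by rw [Site.shift_unshift]⟩
      have h := (key _ _ (U ⟨z, μ⟩)⁻¹ (U' ⟨z, μ⟩)⁻¹ (hs z ν μ (Ne.symm hμν)) (hs₁ z ν μ (Ne.symm hμν))
        ((hk1 _).trans (by linarith))).1
      simp only [walk, holAt_cons, holAt_nil, mul_one, Bool.false_eq_true, if_false, if_true,
        T4ReflectionCone.shift_shift_unshift, Site.unshift_shift]
      convert h using 2
      group
    · -- `(μ,+), (ν,−)`: plaquette `(ν, μ)` at `z = y − e_ν`, conjugator `U⟨z,ν⟩⁻¹`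
      obtain ⟨z, rfl⟩ : ∃ z, y = z.shift ν := ⟨y.unshift ν, by rw [Site.shift_unshift]⟩
      have h := (key _ _ (U ⟨z, ν⟩)⁻¹ (U' ⟨z, ν⟩)⁻¹ (hs z ν μ (Ne.symm hμν)) (hs₁ z ν μ (Ne.symm hμν))
        ((hk1 _).trans (by linarith))).1
      simp only [walk, holAt_cons, holAt_nil, mul_one, Bool.false_eq_true, if_false, if_true,
        T4ReflectionCone.shift_shift_unshift, Site.unshift_shift]
      convert h using 2
      group
    · -- `(μ,+), (ν,+)`: the plaquette at `y`, pair `(μ, ν)`, no conjugator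
      have h := (key _ _ 1 1 (hs y μ ν hμν) (hs₁ y μ ν hμν)
        (by rw [mul_inv_cancel, GaugeGroup.dist1_one]; positivity)).1
      simp only [walk, holAt_cons, holAt_nil, mul_one, if_true]
      convert h using 2
      group

end Pair

/-! ## §2 Words in context, with a length budget `n` -/

section Words

variable (U U' : GaugeField P j G) {s s₁ t : ℝ} (hs0 : 0 ≤ s) (hs₁0 : 0 ≤ s₁) (ht0 : 0 ≤ t)
  (hcomm : ∀ a b : G, dist1 (a * b * a⁻¹ * b⁻¹) ≤ 2 * dist1 a * dist1 b)
  (hs : ∀ (y : Site P j) (μ ν : Fin P.d), μ ≠ ν →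
    dist1 (U ⟨y, μ⟩ * U ⟨y.shift μ, ν⟩ * (U ⟨y.shift ν, μ⟩)⁻¹ * (U ⟨y, ν⟩)⁻¹) ≤ s)
  (hs₁ : ∀ (y : Site P j) (μ ν : Fin P.d), μ ≠ ν →
    dist1 (U' ⟨y, μ⟩ * U' ⟨y.shift μ, ν⟩ * (U' ⟨y.shift ν, μ⟩)⁻¹ * (U' ⟨y, ν⟩)⁻¹ *
      (U ⟨y, μ⟩ * U ⟨y.shift μ, ν⟩ * (U ⟨y.shift ν, μ⟩)⁻¹ * (U ⟨y, ν⟩)⁻¹)⁻¹) ≤ s₁)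
  (ht : ∀ b, dist1 (U' b * (U b)⁻¹) ≤ t)

include hs0 hs₁0 ht0 hcomm hs hs₁ ht in
/-- [folklore] **ONE ADJACENT SWAP, TWO FIELDS**: inside a word of length `≤ n`, swapping two adjacent letters changes the two-field
defect by at most `s₁ + 2·s·t·(n + 2)` (`s₁ + 4st` from the swap quotients, `2·s·|w₁|·t` from the frame change through the two
prefix holonomies). -/
theorem dist1_two_swap (x : Site P j) (w₁ w₂ : List (Letter P.d)) (l₁ l₂ : Letter P.d) {n : ℕ}
    (hn : (w₁ ++ l₁ :: l₂ :: w₂).length ≤ n) :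
    dist1 (holAt U' (walk x (w₁ ++ l₁ :: l₂ :: w₂)) * (holAt U (walk x (w₁ ++ l₁ :: l₂ :: w₂)))⁻¹) ≤
      dist1 (holAt U' (walk x (w₁ ++ l₂ :: l₁ :: w₂)) * (holAt U (walk x (w₁ ++ l₂ :: l₁ :: w₂)))⁻¹) +
        (s₁ + 2 * s * t * (n + 2)) := by
  have e₁ : ∀ V : GaugeField P j G, holAt V (walk x (w₁ ++ l₁ :: l₂ :: w₂)) =
      holAt V (walk x w₁) * (holAt V (walk (walkEnd x w₁) [l₁, l₂]) * holAt V (walk (walkEnd (walkEnd x w₁) [l₁, l₂]) w₂)) := by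
    intro V
    have : w₁ ++ l₁ :: l₂ :: w₂ = w₁ ++ ([l₁, l₂] ++ w₂) := rfl
    rw [this, walk_append, holAt_append, walk_append, holAt_append]
  have e₂ : ∀ V : GaugeField P j G, holAt V (walk x (w₁ ++ l₂ :: l₁ :: w₂)) =
      holAt V (walk x w₁) * (holAt V (walk (walkEnd x w₁) [l₂, l₁]) * holAt V (walk (walkEnd (walkEnd x w₁) [l₁, l₂]) w₂)) := by
    intro V
    have : w₁ ++ l₂ :: l₁ :: w₂ = w₁ ++ ([l₂, l₁] ++ w₂) := rfl
    rw [this, walk_append, holAt_append, walk_append, holAt_append, walkEnd_pair_comm _ l₂ l₁]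
  rw [e₁ U, e₁ U', e₂ U, e₂ U']
  refine (dist1_frame_change hcomm (holAt U (walk x w₁)) (holAt U' (walk x w₁))
    (holAt U (walk (walkEnd x w₁) [l₁, l₂])) (holAt U' (walk (walkEnd x w₁) [l₁, l₂]))
    (holAt U (walk (walkEnd x w₁) [l₂, l₁])) (holAt U' (walk (walkEnd x w₁) [l₂, l₁]))
    (holAt U (walk (walkEnd (walkEnd x w₁) [l₁, l₂]) w₂)) (holAt U' (walk (walkEnd (walkEnd x w₁) [l₁, l₂]) w₂))).trans ?_
  have hQ := dist1_pair_swap_quot U U' hs0 hs₁0 ht0 hcomm hs hs₁ ht (walkEnd x w₁) l₁ l₂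
  have hq : dist1 (holAt U (walk (walkEnd x w₁) [l₁, l₂]) * (holAt U (walk (walkEnd x w₁) [l₂, l₁]))⁻¹) ≤ s :=
    dist1_holAt_pair_swap U hs0 hs _ l₁ l₂
  have hA := dist1_holAt_walk_two_le U U' ht x w₁
  have hw₁ : (w₁.length : ℝ) ≤ n := by
    have : w₁.length ≤ n := by simp only [List.length_append, List.length_cons] at hn; omega
    exact_mod_cast this
  have hqn : 0 ≤ dist1 (holAt U (walk (walkEnd x w₁) [l₁, l₂]) * (holAt U (walk (walkEnd x w₁) [l₂, l₁]))⁻¹) :=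
    GaugeGroup.dist1_nonneg _
  have hAn : 0 ≤ dist1 (holAt U' (walk x w₁) * (holAt U (walk x w₁))⁻¹) := GaugeGroup.dist1_nonneg _
  nlinarith [mul_le_mul hq (hA.trans (mul_le_mul_of_nonneg_right hw₁ ht0)) hAn hs0, mul_nonneg hs0 ht0]

/-- [folklore] **CANCELLATION, TWO FIELDS**: deleting an adjacent pair `l, l⁻¹` does not change the two-field defect. -/
theorem dist1_two_cancel (x : Site P j) (w₁ w₂ : List (Letter P.d)) (l : Letter P.d) :
    dist1 (holAt U' (walk x (w₁ ++ l :: l.flip :: w₂)) * (holAt U (walk x (w₁ ++ l :: l.flip :: w₂)))⁻¹) =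
      dist1 (holAt U' (walk x (w₁ ++ w₂)) * (holAt U (walk x (w₁ ++ w₂)))⁻¹) := by
  rw [holAt_walk_cancel, holAt_walk_cancel]

include hs0 hs₁0 ht0 hcomm hs hs₁ ht in
/-- [folklore] **A LETTER MOVED PAST A BLOCK `B`, TWO FIELDS**: `+ |B|·(s₁ + 2·s·t·(n+2))`. -/
theorem dist1_two_letter_past (x : Site P j) (l : Letter P.d) {n : ℕ} : ∀ (B w₁ w₂ : List (Letter P.d)),
    (w₁ ++ l :: (B ++ w₂)).length ≤ n →
    dist1 (holAt U' (walk x (w₁ ++ l :: (B ++ w₂))) * (holAt U (walk x (w₁ ++ l :: (B ++ w₂))))⁻¹) ≤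
      dist1 (holAt U' (walk x (w₁ ++ (B ++ l :: w₂))) * (holAt U (walk x (w₁ ++ (B ++ l :: w₂))))⁻¹) +
        B.length * (s₁ + 2 * s * t * (n + 2))
  | [], w₁, w₂, _ => by simp
  | b :: B, w₁, w₂, hn => by
    have h1 := dist1_two_swap U U' hs0 hs₁0 ht0 hcomm hs hs₁ ht x w₁ (B ++ w₂) l b (by simpa using hn)
    have hn' : (w₁ ++ [b] ++ l :: (B ++ w₂)).length ≤ n := by
      simp only [List.length_append, List.length_cons, List.length_nil] at hn ⊢; omega
    have h2 := dist1_two_letter_past x l B (w₁ ++ [b]) w₂ hn'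
    have e1 : w₁ ++ [b] ++ l :: (B ++ w₂) = w₁ ++ b :: l :: (B ++ w₂) := by simp
    have e2 : w₁ ++ [b] ++ (B ++ l :: w₂) = w₁ ++ (b :: B ++ l :: w₂) := by simp
    rw [e1, e2] at h2
    have e3 : w₁ ++ l :: (b :: B ++ w₂) = w₁ ++ l :: b :: (B ++ w₂) := by simp
    rw [e3]
    calc dist1 (holAt U' (walk x (w₁ ++ l :: b :: (B ++ w₂))) * (holAt U (walk x (w₁ ++ l :: b :: (B ++ w₂))))⁻¹)
        ≤ dist1 (holAt U' (walk x (w₁ ++ b :: l :: (B ++ w₂))) * (holAt U (walk x (w₁ ++ b :: l :: (B ++ w₂))))⁻¹) +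
            (s₁ + 2 * s * t * (n + 2)) := h1
      _ ≤ dist1 (holAt U' (walk x (w₁ ++ (b :: B ++ l :: w₂))) * (holAt U (walk x (w₁ ++ (b :: B ++ l :: w₂))))⁻¹) +
            B.length * (s₁ + 2 * s * t * (n + 2)) + (s₁ + 2 * s * t * (n + 2)) := by linarith
      _ = _ := by push_cast [List.length_cons]; ring

include hs0 hs₁0 ht0 hcomm hs hs₁ ht in
/-- [folklore] **A BLOCK `A` MOVED PAST A BLOCK `B`, TWO FIELDS**: `+ |A|·|B|·(s₁ + 2·s·t·(n+2))`. -/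
theorem dist1_two_block_past (x : Site P j) (B : List (Letter P.d)) {n : ℕ} : ∀ (A w₁ w₂ : List (Letter P.d)),
    (w₁ ++ (A ++ (B ++ w₂))).length ≤ n →
    dist1 (holAt U' (walk x (w₁ ++ (A ++ (B ++ w₂)))) * (holAt U (walk x (w₁ ++ (A ++ (B ++ w₂)))))⁻¹) ≤
      dist1 (holAt U' (walk x (w₁ ++ (B ++ (A ++ w₂)))) * (holAt U (walk x (w₁ ++ (B ++ (A ++ w₂)))))⁻¹) +
        A.length * B.length * (s₁ + 2 * s * t * (n + 2))
  | [], w₁, w₂, _ => by simp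
  | a :: A, w₁, w₂, hn => by
    have hn1 : (w₁ ++ [a] ++ (A ++ (B ++ w₂))).length ≤ n := by
      simp only [List.length_append, List.length_cons, List.length_nil, List.cons_append] at hn ⊢; omega
    have h1 := dist1_two_block_past x B A (w₁ ++ [a]) w₂ hn1
    have hn2 : (w₁ ++ a :: (B ++ (A ++ w₂))).length ≤ n := by
      simp only [List.length_append, List.length_cons, List.cons_append] at hn ⊢; omega
    have h2 := dist1_two_letter_past U U' hs0 hs₁0 ht0 hcomm hs hs₁ ht x a B w₁ (A ++ w₂) hn2
    have e1 : w₁ ++ [a] ++ (A ++ (B ++ w₂)) = w₁ ++ (a :: A ++ (B ++ w₂)) := by simp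
    have e2 : w₁ ++ [a] ++ (B ++ (A ++ w₂)) = w₁ ++ a :: (B ++ (A ++ w₂)) := by simp
    have e3 : w₁ ++ (B ++ a :: (A ++ w₂)) = w₁ ++ (B ++ (a :: A ++ w₂)) := by simp
    rw [e1, e2] at h1
    rw [e3] at h2
    have hC : 0 ≤ s₁ + 2 * s * t * (n + 2) := by positivity
    calc dist1 (holAt U' (walk x (w₁ ++ (a :: A ++ (B ++ w₂)))) * (holAt U (walk x (w₁ ++ (a :: A ++ (B ++ w₂)))))⁻¹)
        ≤ dist1 (holAt U' (walk x (w₁ ++ (B ++ (a :: A ++ w₂)))) * (holAt U (walk x (w₁ ++ (B ++ (a :: A ++ w₂)))))⁻¹) +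
            A.length * B.length * (s₁ + 2 * s * t * (n + 2)) + B.length * (s₁ + 2 * s * t * (n + 2)) := by linarith
      _ = _ := by push_cast [List.length_cons]; ring

/-- [folklore] **RUN CANCELLATION, TWO FIELDS**: `w₁ l^k (l⁻¹)^k w₂` and `w₁ w₂` have the same two-field defect. -/
theorem dist1_two_cancel_runs (x : Site P j) (l : Letter P.d) (k : ℕ) (w₁ w₂ : List (Letter P.d)) :
    dist1 (holAt U' (walk x (w₁ ++ (List.replicate k l ++ (List.replicate k l.flip ++ w₂)))) *
        (holAt U (walk x (w₁ ++ (List.replicate k l ++ (List.replicate k l.flip ++ w₂)))))⁻¹) =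
      dist1 (holAt U' (walk x (w₁ ++ w₂)) * (holAt U (walk x (w₁ ++ w₂)))⁻¹) := by
  rw [holAt_walk_cancel_runs, holAt_walk_cancel_runs]

end Words

/-! ## §3 From `plaqHol` to the ordered-pair variation hypothesis -/

/-- [folklore] a bound on all `dist1 (plaqHol U′ p · (plaqHol U p)⁻¹)` is a bound on the variation of every ordered-pair plaquette
variable (for `μ > ν` both ordered pairs are the inverses of `plaqHol` at the transposed plaquette). -/
theorem plaq_pair_diff_bound_of_plaqHol (U U' : GaugeField P j G) {s₁ : ℝ}
    (hp : ∀ p : Plaq P j, dist1 (GaugeField.plaqHol U' p * (GaugeField.plaqHol U p)⁻¹) ≤ s₁)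
    (y : Site P j) (μ ν : Fin P.d) (hμν : μ ≠ ν) :
    dist1 (U' ⟨y, μ⟩ * U' ⟨y.shift μ, ν⟩ * (U' ⟨y.shift ν, μ⟩)⁻¹ * (U' ⟨y, ν⟩)⁻¹ *
      (U ⟨y, μ⟩ * U ⟨y.shift μ, ν⟩ * (U ⟨y.shift ν, μ⟩)⁻¹ * (U ⟨y, ν⟩)⁻¹)⁻¹) ≤ s₁ := by
  rcases lt_or_gt_of_ne hμν with h | h
  · exact hp ⟨y, μ, ν, h⟩
  · have key := hp ⟨y, ν, μ, h⟩
    rw [← dist1_quot_inv] at key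
    convert key using 2
    simp only [GaugeField.plaqHol]
    group

end Summit.QuantumFields.BalabanUV.T4Continuum.B13AvgCorrStokesVariation

end
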